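import Mathlib
import Summits.Ventures.PercRepro2.MonoTPos
import Summits.Ventures.PercRepro2.GcInterior
import Summits.Ventures.PercRepro2.GcInteriorPos
import Summits.Ventures.PercRepro2.CaseOneRegime
import Summits.Ventures.PercRepro2.CaseOneRV
import Summits.Ventures.PercRepro2.PathMixKernel
import Summits.Ventures.PercRepro2.PathMixCanonical
import Summits.Ventures.PercRepro2.GcSkelReductionMinH

/-!
# S5's non-degeneracy hypotheses discharged on the residual at interior weights
(blind cell PercRepro2, typer-1 g55)

The case-1 rung of S5 (`PathMix.rv_of_canonPM`, `PathMix.zSplitII_of_canonPM`) carries four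
positivity hypotheses in the `jOneB` vocabulary: `P(Q) = P((a₁ ↔ a₂)ᶜ) > 0`, `D = Dpd > 0`,
`M = Σ_T c_T m_T > 0` (the canonical records) and `P(T′) = P(Tp) > 0`. At interior weights
(`IsIntVec p`, `GcInterior.lean`) every non-empty event has positive probability
(`prob_pos_of_int`, `GcInteriorPos.lean`), and on the weighted residual `WReducedI` all four
events are non-empty — the all-closed configuration for `Q` and `D`, the configuration `G − a₂`
for `T′` (`a₁ ↔ a₃` there: `conn_sepConfig_a2_of_wredI`), and `M = P(T′)` on the canonical
records (`sum_recCM` + `isCylinderPartition_canonRecords`: **`canonM_eq`**):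

* `CaseOne.Q_pos_of_int`, `CaseOne.Dpd_pos_of_int`, `CaseOne.Tp_pos_of_int`, `WRed.Tp_pos_of_wredI`,
  `PathMix.canonM_pos_of_wredI`;
* **`PathMix.rv_of_canonPM_of_wredI`** / **`PathMix.zSplitII_of_canonPM_of_wredI`**: on the
  residual at interior weights, `0 ≤ canonPM ⟹ (RV)` / `⟹ (ii)` with NO side condition; the same
  on the class of record (`…_of_wredMinH`).
-/

namespace Summit.Ventures.PercRepro2

open CovForm SepPair

/-! ## The `jOneB` masses at interior weights -/

section CaseOneMasses

variable {V : Type*} {E : Type*} [Fintype E] [DecidableEq E] {R : Type*} [Field R]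
  [LinearOrder R] [IsStrictOrderedRing R]

/-- **`P(Q) > 0`** in the spelling `(connEvent ends a₁ a₂)ᶜ`, at interior weights, `a₁ ≠ a₂`. -/
theorem CaseOne.Q_pos_of_int {p : E → R} (hp : IsIntVec p) (ends : E → Sym2 V) {a₁ a₂ : V}
    (h12 : a₁ ≠ a₂) : 0 < prob p (connEvent ends a₁ a₂)ᶜ :=
  prob_pos_of_int hp ⟨fun _ => false, fun h => h12 ((conn_allClosed_iff _ _ _).1 h)⟩

/-- **`D = Dpd > 0`** at interior weights when the three marks are distinct. -/
theorem CaseOne.Dpd_pos_of_int {p : E → R} (hp : IsIntVec p) (ends : E → Sym2 V) {a₁ a₂ a₃ : V}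
    (h12 : a₁ ≠ a₂) (h13 : a₁ ≠ a₃) (h23 : a₂ ≠ a₃) : 0 < CaseOne.Dpd p ends a₁ a₂ a₃ :=
  prob_pos_of_int hp ⟨fun _ => false,
    ⟨⟨fun h => h13 ((conn_allClosed_iff _ _ _).1 h), fun h => h23 ((conn_allClosed_iff _ _ _).1 h)⟩,
      fun h => h12 ((conn_allClosed_iff _ _ _).1 h)⟩⟩

/-- **`P(T′) = P(Tp) > 0`** at interior weights when `a₁ ↔ a₃` in `G − a₂`. -/
theorem CaseOne.Tp_pos_of_int {p : E → R} (hp : IsIntVec p) (ends : E → Sym2 V) {a₁ a₂ a₃ : V}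
    (h12 : a₁ ≠ a₂) (hconn : Conn ends (sepConfig ends {a₂}) a₁ a₃) :
    0 < prob p (CaseOne.Tp ends a₁ a₂ a₃) :=
  prob_pos_of_int hp ⟨sepConfig ends {a₂}, not_conn_sepConfig_singleton h12, hconn⟩

end CaseOneMasses

namespace WRed

section ResidualTp

variable {V : Type*} {E : Type*} [Fintype E] [DecidableEq E] [DecidableEq V] {R : Type*}
  [Field R] [LinearOrder R] [IsStrictOrderedRing R]
variable {ends : E → Sym2 V} {o a₁ a₂ a₃ b : V}

/-- **`P(T′) = P(Tp) > 0` on the residual at interior weights.** -/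
theorem Tp_pos_of_wredI {p : E → R} (hp : IsIntVec p) (h : WReducedI ends o a₁ a₂ a₃ b)
    (h12 : a₁ ≠ a₂) (h13 : a₁ ≠ a₃) (h23 : a₂ ≠ a₃) (ho1 : o ≠ a₁) (ho2 : o ≠ a₂) (ho3 : o ≠ a₃)
    (hob : o ≠ b) (hb1 : b ≠ a₁) (hb2 : b ≠ a₂) (hb3 : b ≠ a₃) :
    0 < prob p (CaseOne.Tp ends a₁ a₂ a₃) :=
  CaseOne.Tp_pos_of_int hp ends h12
    (conn_sepConfig_a2_of_wredI h h12 h13 h23 ho1 ho2 ho3 hob hb1 hb2 hb3)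

end ResidualTp

end WRed

/-! ## The canonical records: `M = P(T′)` -/

namespace PathMix

open Explore CylinderCond CylinderCov

section Canonical

variable {V : Type*} {E : Type*} [Fintype E] [DecidableEq E] [Fintype V] [DecidableEq V]
  {ends : E → Sym2 V} {R : Type*} [Field R] [LinearOrder R] [IsStrictOrderedRing R]

omit [LinearOrder R] [IsStrictOrderedRing R] in
/-- **`M = Σ_T c_T m_T = P(Q, a₃ ∈ C₁) = P(T′)`** on the canonical records. -/
theorem canonM_eq (sel : Selector ends) (p : E → R) (a₁ a₂ a₃ : V) :
    ∑ T ∈ canonRecords sel a₁ a₃,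
        recC p Record.explored recSigma T * recM p ends a₁ a₂ Record.explored recSigma T =
      prob p (CaseOne.Tp ends a₁ a₂ a₃) := by
  rw [sum_recCM p ends a₁ a₂ a₃ (isCylinderPartition_canonRecords sel a₁ a₃),
    CaseOne.expect_ind2]
  rfl

variable {o a₁ a₂ a₃ b : V}

/-- **`M > 0` on the residual at interior weights.** -/
theorem canonM_pos_of_wredI (sel : Selector ends) {p : E → R} (hp : IsIntVec p)
    (h : WRed.WReducedI ends o a₁ a₂ a₃ b)
    (h12 : a₁ ≠ a₂) (h13 : a₁ ≠ a₃) (h23 : a₂ ≠ a₃) (ho1 : o ≠ a₁) (ho2 : o ≠ a₂) (ho3 : o ≠ a₃)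
    (hob : o ≠ b) (hb1 : b ≠ a₁) (hb2 : b ≠ a₂) (hb3 : b ≠ a₃) :
    0 < ∑ T ∈ canonRecords sel a₁ a₃,
        recC p Record.explored recSigma T * recM p ends a₁ a₂ Record.explored recSigma T := by
  rw [canonM_eq]
  exact WRed.Tp_pos_of_wredI hp h h12 h13 h23 ho1 ho2 ho3 hob hb1 hb2 hb3

/-- **`PM ≥ 0 ⟹ (RV)` on the residual at interior weights — no side condition**: S5's
`rv_of_canonPM` with its four positivity hypotheses discharged. -/
theorem rv_of_canonPM_of_wredI (sel : Selector ends) {p : E → R} (hp : IsIntVec p)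
    (h : WRed.WReducedI ends o a₁ a₂ a₃ b)
    (h12 : a₁ ≠ a₂) (h13 : a₁ ≠ a₃) (h23 : a₂ ≠ a₃) (ho1 : o ≠ a₁) (ho2 : o ≠ a₂) (ho3 : o ≠ a₃)
    (hob : o ≠ b) (hb1 : b ≠ a₁) (hb2 : b ≠ a₂) (hb3 : b ≠ a₃)
    (hpm : 0 ≤ canonPM sel p o a₁ a₂ a₃ b) : CaseOne.RV p ends o a₁ a₂ a₃ b :=
  rv_of_canonPM sel p hp.isProbVec o a₁ a₂ a₃ b (CaseOne.Q_pos_of_int hp ends h12)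
    (CaseOne.Dpd_pos_of_int hp ends h12 h13 h23)
    (canonM_pos_of_wredI sel hp h h12 h13 h23 ho1 ho2 ho3 hob hb1 hb2 hb3)
    (WRed.Tp_pos_of_wredI hp h h12 h13 h23 ho1 ho2 ho3 hob hb1 hb2 hb3) hpm

/-- **`PM ≥ 0 ⟹ (ii)` on the residual at interior weights — no side condition.** -/
theorem zSplitII_of_canonPM_of_wredI (sel : Selector ends) {p : E → R} (hp : IsIntVec p)
    (h : WRed.WReducedI ends o a₁ a₂ a₃ b)
    (h12 : a₁ ≠ a₂) (h13 : a₁ ≠ a₃) (h23 : a₂ ≠ a₃) (ho1 : o ≠ a₁) (ho2 : o ≠ a₂) (ho3 : o ≠ a₃)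
    (hob : o ≠ b) (hb1 : b ≠ a₁) (hb2 : b ≠ a₂) (hb3 : b ≠ a₃)
    (hpm : 0 ≤ canonPM sel p o a₁ a₂ a₃ b) : CaseOne.ZSplitII p ends o a₁ a₂ a₃ b :=
  zSplitII_of_canonPM sel p hp.isProbVec o a₁ a₂ a₃ b (CaseOne.Q_pos_of_int hp ends h12)
    (CaseOne.Dpd_pos_of_int hp ends h12 h13 h23)
    (canonM_pos_of_wredI sel hp h h12 h13 h23 ho1 ho2 ho3 hob hb1 hb2 hb3) hpm

/-- `PM ≥ 0 ⟹ (RV)` on the class of record at interior weights. -/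
theorem rv_of_canonPM_of_wredMinH (sel : Selector ends) {p : E → R} (hp : IsIntVec p)
    (h : WRed.WReducedMinH ends o a₁ a₂ a₃ b)
    (h12 : a₁ ≠ a₂) (h13 : a₁ ≠ a₃) (h23 : a₂ ≠ a₃) (ho1 : o ≠ a₁) (ho2 : o ≠ a₂) (ho3 : o ≠ a₃)
    (hob : o ≠ b) (hb1 : b ≠ a₁) (hb2 : b ≠ a₂) (hb3 : b ≠ a₃)
    (hpm : 0 ≤ canonPM sel p o a₁ a₂ a₃ b) : CaseOne.RV p ends o a₁ a₂ a₃ b :=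
  rv_of_canonPM_of_wredI sel hp (WRed.wredI_of_wredMinH h) h12 h13 h23 ho1 ho2 ho3 hob hb1 hb2 hb3
    hpm

end Canonical

end PathMix

end Summit.Ventures.PercRepro2
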